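import Summits.HodgeConjecture.HodgeConjecture.Theorems.MarkmanPartnerTransportLowPicardRMCellGenPrime
import Summits.HodgeConjecture.HodgeConjecture.Theorems.MarkmanPartnerTransportLowPicardRMOddCellSockets
import Summits.HodgeConjecture.HodgeConjecture.Theorems.MarkmanPartnerTransportLowPicardRMCellsKappa
import Summits.HodgeConjecture.HodgeConjecture.Theorems.MarkmanPartnerTransportLowPicardRMSectors

/-!
# Route MarkmanPartnerTransport · crux #5 `LowPicardRealMultiplication` — «CELL-GEN SOCKET»: one GENERATING cycle
# per member gives HC⁴ on EVERY cell, and crux #5 BY NAME — no degree law, no Kuga–Satake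

Planner p1 g39 GO «CELL-GEN SOCKET» (2026-08-28T16:43Z); prover seat hodge-nonav-20241-p1 (gen 15). Consumer of the
route-independent core `genX_of_rmGenerator_of_eigenvalue_natDegree` (`…LowPicardRMCellGen`): inside a cell `(ρ, d)`
the `RMgen` datum pins `[E:ℚ] = d`, so ONE algebraic class `Z ∈ A⁴(X × X)` acting rationally and type-preservingly
with `σ`-eigenvalue of minpoly degree `d` (`OneCellCycle[X, φ, z, hX, d]`, VERBATIM `…LowPicardRMOddCellSockets`)
GENERATES the transcendental Hodge endomorphisms (`GenX`), and the `X`-side F4 `hodgeConjectureFor_of_cycleInducedGenerator`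
concludes — uniformly on all six cells, in particular on `(3,2)` where the degree law of `…LowPicardRMOddCellSockets`
fails (`2·2·5 + 3 = 23`), with NO Kuga–Satake binder.

* `hodgeConjectureFor_of_oneCellCycle_of_rmGenerator` — **POINTWISE CELL SOCKET, any cell**: marked smooth projective
  `K3^{[2]}`-type `X`, `RMgen[X, φ, z, d]`, `OneCellCycle[X, φ, z, hX, d]` ⟹ `HodgeConjectureFor 4 X`, modulo EXACTLY
  {`VerbitskyGuan_cohomology_K3HilbertSquareType`, `OGrady2008_dualBBFClass_algebraic`, `QInvAlgebraic`}
  (`…_of_charlesMarkman`: {Verbitsky–Guan, O'Grady, `CharlesMarkman2013_lefschetzStandard_K3HilbertType`}); no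
  `¬ SpannedByIsometries`, no degree law, no parity, no Kuga–Satake;
* `cellHC_of_forall_oneGenCycle` — **`OneCycleOnCell[ρ, d] → CellHC[ρ, d]` for EVERY `(ρ, d)`**;
* `lowPicardRealMultiplication_of_forall_oneGenCycle` (+ `…_of_charlesMarkman`) — **crux #5 BY NAME ⟸ one generating
  cycle per member on each of its six cells** («CELL-SPLIT» `lowPicardRealMultiplication_of_six_cells`); and the
  cell-free form `lowPicardRealMultiplication_of_forall_oneGenCycle_of_rmGenerator` — crux #5 ⟸ «every marked
  `K3^{[2]}`-type `X` with `ρ(X) ≤ 3` and an RM generator of degree `d ≥ 2` carries one algebraic self-correspondence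
  whose `σ`-eigenvalue has degree `d`» («RM-GEN» `exists_rmGenerator_of_not_spannedByIsometries`).
* PRIME DEGREE (`…LowPicardRMCellGenPrime`: in a cell with `d` prime ANY irrational `σ`-eigenvalue has degree `d`):
  `hodgeConjectureFor_of_oneIrrCycle_of_rmGenerator_prime` (pointwise), `cellHC_of_forall_oneIrrCycle` (`d` prime:
  one cycle with an IRRATIONAL `σ`-eigenvalue per member ⟹ `CellHC[ρ, d]`) and
  `lowPicardRealMultiplication_of_forall_oneIrrCycle_of_oneGenCycle34` — **crux #5 BY NAME ⟸ one cycle with an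
  irrational `σ`-eigenvalue per member on the five prime cells `(1,2), (2,3), (2,7), (3,2), (3,5)` + one cycle with a
  QUARTIC `σ`-eigenvalue per member on `(3,4)`**.
* LOSSLESS: `oneCellCycle_of_hodgeConjectureFor_of_rmGenerator` (HC⁴(X) ⟹ the RM generator `θ` ITSELF is cycle-induced:
  `κ_θ` is a rational `(2,2)`-class, hence algebraic, so T3C `exists_corrAction_eq_of_kappaClass` applies),
  `cellHC_iff_oneCycleOnCell` — **`CellHC[ρ, d] ↔ OneCycleOnCell[ρ, d]`** — and
  `lowPicardRealMultiplication_iff_forall_oneGenCycle` — **crux #5 ⟺ one generating cycle per member on each of its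
  six cells**, modulo {Verbitsky–Guan, O'Grady, Charles–Markman 2013}: the one-cycle form of the crux is EXACT.

CONDITIONAL on the displayed named facts and on the one-cycle clauses (open geometry: Hecke sources, NS-absorption
seeds — chapter P1AL); no definition, no sorry. `--supports stmt-HodgeConjecture-19653`. Nothing here proves the crux or HC.

References: E. Markman, Compos. Math. 160 (2024) Thm. 1.1; M. Varesco, Math. Z. 305 (2023) §2; Yu. Zarhin, J. reine
angew. Math. 341 (1983) Thm. 1.5.1; B. van Geemen, Michigan Math. J. 56 (2008) Lemma 3.2.
-/

noncomputable section

set_option linter.dupNamespace false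

open Module CategoryTheory MonoidalCategory Polynomial
open Literature.AlgebraicTopology.SingularHomology Literature.Geometry.Kaehler
open Literature.AlgebraicGeometry Literature.AlgebraicGeometry.Motives Literature.AlgebraicGeometry.HodgeTheory
open Literature.AlgebraicGeometry.Hyperkaehler Literature.AlgebraicGeometry.Surfaces
open Summit.HodgeConjecture.HodgeConjecture.Theorems.NikulinTwinTransport

namespace Summit.HodgeConjecture.HodgeConjecture.Theorems.MarkmanPartnerTransport.PartnerLattice

/-- `MarkedK3Sq[X, φ, P, z]`: VERBATIM the `let MarkedK3Sq := …` binder of the route declarations of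
MarkmanPartnerTransport (clauses (m1)–(m6)). Local notation only. -/
local notation3 (prettyPrint := false) "MarkedK3Sq[" X ", " φ ", " P ", " z "]" =>
  (((IsIntegralClass P ∧ ∀ Q : complexBetti X (2 * 4), IsIntegralClass Q → ∃ n : ℤ, Q = n • P) ∧
    (∀ c : complexBetti X 2, IsIntegralClass c ↔ ∃ v : K3HilbertIndex → ℤ, φ c = fun i => (v i : ℂ)) ∧
    (∀ a : complexBetti X 2, cupPowTwo a 4 = ((3 : ℂ) * (k3HilbertForm 2 (φ a) (φ a)) ^ 2) • P) ∧
    (IsOfHodgeType 4 X 2 2 0 (LinearEquiv.symm φ z) ∧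
      ∀ τ : complexBetti X 2, IsOfHodgeType 4 X 2 2 0 τ → ∃ t : ℂ, τ = t • LinearEquiv.symm φ z) ∧
    (∀ c : complexBetti X 2, IsOfHodgeType 4 X 2 1 1 c ↔
      (k3HilbertForm 2 (φ c) z = 0 ∧ k3HilbertForm 2 (φ c) (star z) = 0)) ∧
    (k3HilbertForm 2 z z = 0 ∧ 0 < (k3HilbertForm 2 (star z) z).re)))

/-- `SpIso[X, φ]`: VERBATIM the `let SpannedByIsometries := …` binder of the route declarations (with
`IsBBFTransc` unfolded). Local notation only. -/
local notation3 (prettyPrint := false) "SpIso[" X ", " φ "]" =>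
  (∀ f : complexBetti X 2 →ₗ[ℂ] complexBetti X 2, (∀ y, IsRationalClass y → IsRationalClass (f y)) →
    (∀ (i j : ℕ) y, IsOfHodgeType 4 X 2 i j y → IsOfHodgeType 4 X 2 i j (f y)) →
    (∀ d : complexBetti X 2, d ∈ algebraicClasses X 1 → f d = 0) →
    (∀ y : complexBetti X 2, ∀ d : complexBetti X 2, d ∈ algebraicClasses X 1 →
      k3HilbertForm 2 (φ (f y)) (φ d) = 0) →
    ∃ (k : ℕ) (c : Fin k → ℚ) (g : Fin k → (complexBetti X 2 →ₗ[ℂ] complexBetti X 2)),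
      (∀ i, Function.Bijective (g i) ∧ (∀ y, IsRationalClass y → IsRationalClass (g i y)) ∧
        (∀ (a b : ℕ) y, IsOfHodgeType 4 X 2 a b y → IsOfHodgeType 4 X 2 a b (g i y)) ∧
        (∀ a b, k3HilbertForm 2 (φ (g i a)) (φ (g i b)) = k3HilbertForm 2 (φ a) (φ b))) ∧
      ∀ y : complexBetti X 2, (∀ d : complexBetti X 2, d ∈ algebraicClasses X 1 →
        k3HilbertForm 2 (φ y) (φ d) = 0) → f y = ∑ i : Fin k, ((c i : ℂ) • g i y))

/-- `RMgen[X, φ, z, d]` (VERBATIM `…LowPicardRMCells`). Local notation only. -/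
local notation3 (prettyPrint := false) "RMgen[" X ", " φ ", " z ", " d "]" =>
  (∃ θ : complexBetti X 2 →ₗ[ℂ] complexBetti X 2, (∀ y, IsRationalClass y → IsRationalClass (θ y)) ∧
    (∀ (i j : ℕ) y, IsOfHodgeType 4 X 2 i j y → IsOfHodgeType 4 X 2 i j (θ y)) ∧
    (∀ y w : complexBetti X 2, k3HilbertForm 2 (φ (θ y)) (φ w) = k3HilbertForm 2 (φ y) (φ (θ w))) ∧
    ∃ ev : ℂ, θ (LinearEquiv.symm φ z) = ev • LinearEquiv.symm φ z ∧ ev.im = 0 ∧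
      (minpoly ℚ ev).natDegree = d ∧
      (∃ n : ℕ, 3 ≤ n ∧ d * n + Module.finrank ℂ ↥(algebraicClasses X 1) = 23) ∧
      ∀ f : complexBetti X 2 →ₗ[ℂ] complexBetti X 2, (∀ y, IsRationalClass y → IsRationalClass (f y)) →
        (∀ (i j : ℕ) y, IsOfHodgeType 4 X 2 i j y → IsOfHodgeType 4 X 2 i j (f y)) →
        ∃ c : Fin d → ℚ, ∀ y : complexBetti X 2,
          (∀ a : complexBetti X 2, a ∈ algebraicClasses X 1 → k3HilbertForm 2 (φ y) (φ a) = 0) →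
            f y = ∑ i : Fin d, ((c i : ℂ) • (θ ^ (i : ℕ)) y))

/-- `CellHC[ρ, d]` (VERBATIM `…LowPicardRMCells`): **HC⁴ on the cell `(ρ(X), [E:ℚ]) = (ρ, d)`**. Local notation only. -/
local notation3 (prettyPrint := false) "CellHC[" ρ ", " d "]" =>
  (∀ (X : SchemeOver ℂ), IsSmoothProjective 4 X → IsOfK3HilbertSquareType X →
    ∀ (φ : complexBetti X 2 ≃ₗ[ℂ] (K3HilbertIndex → ℂ)) (P : complexBetti X (2 * 4)) (z : K3HilbertIndex → ℂ),
      MarkedK3Sq[X, φ, P, z] → ¬ SpIso[X, φ] → Module.finrank ℂ ↥(algebraicClasses X 1) = ρ →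
        RMgen[X, φ, z, d] → HodgeConjectureFor 4 X)

/-- `OneCellCycle[X, φ, z, hX, d]` (VERBATIM `…LowPicardRMOddCellSockets`): ONE algebraic `Z ∈ A⁴(X × X)` whose action
on `H²(X)` is rational, type-preserving, with `σ`-eigenvalue of minpoly degree EXACTLY `d`. Local notation only. -/
local notation3 (prettyPrint := false) "OneCellCycle[" X ", " φ ", " z ", " hX ", " d "]" =>
  (∃ t : complexBetti X 2 →ₗ[ℂ] complexBetti X 2,
    (∀ y, IsRationalClass y → IsRationalClass (t y)) ∧
    (∀ (a b : ℕ) y, IsOfHodgeType 4 X 2 a b y → IsOfHodgeType 4 X 2 a b (t y)) ∧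
    (∃ Z ∈ algebraicClasses (X ⊗ X) 4, ∀ y : complexBetti X 2,
      t y = corrAction complexOrientationFamily hX hX (rfl : 2 + 2 * 4 = 2 + 2 * 4) Z y) ∧
    ∃ ev : ℂ, t (LinearEquiv.symm φ z) = ev • LinearEquiv.symm φ z ∧ (minpoly ℚ ev).natDegree = d)

/-- `OneCycleOnCell[ρ, d]` (VERBATIM `…LowPicardRMOddCellSockets`): «every member of the cell `(ρ, d)` carries one
degree-`d` RM cycle». Local notation only. -/
local notation3 (prettyPrint := false) "OneCycleOnCell[" ρ ", " d "]" =>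
  (∀ (X : SchemeOver ℂ) (hX : IsSmoothProjective 4 X), IsOfK3HilbertSquareType X →
    ∀ (φ : complexBetti X 2 ≃ₗ[ℂ] (K3HilbertIndex → ℂ)) (P : complexBetti X (2 * 4)) (z : K3HilbertIndex → ℂ),
      MarkedK3Sq[X, φ, P, z] → ¬ SpIso[X, φ] → Module.finrank ℂ ↥(algebraicClasses X 1) = ρ →
        RMgen[X, φ, z, d] → OneCellCycle[X, φ, z, hX, d])

/-- `OneIrrCycle[X, φ, z, hX]`: ONE algebraic `Z ∈ A⁴(X × X)` whose action on `H²(X)` is rational, type-preserving, with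
an IRRATIONAL `σ`-eigenvalue (VERBATIM the `t`-clause of `lowPicardRealMultiplication_of_oneCycleFifth_prime`,
`…K3Sq2OneCycleFifth`, without its arithmetic side condition). Local notation only. -/
local notation3 (prettyPrint := false) "OneIrrCycle[" X ", " φ ", " z ", " hX "]" =>
  (∃ t : complexBetti X 2 →ₗ[ℂ] complexBetti X 2,
    (∀ y, IsRationalClass y → IsRationalClass (t y)) ∧
    (∀ (a b : ℕ) y, IsOfHodgeType 4 X 2 a b y → IsOfHodgeType 4 X 2 a b (t y)) ∧
    (∃ Z ∈ algebraicClasses (X ⊗ X) 4, ∀ y : complexBetti X 2,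
      t y = corrAction complexOrientationFamily hX hX (rfl : 2 + 2 * 4 = 2 + 2 * 4) Z y) ∧
    ∃ ev : ℂ, t (LinearEquiv.symm φ z) = ev • LinearEquiv.symm φ z ∧ ∀ a : ℚ, (a : ℂ) ≠ ev)

/-- `OneIrrCycleOnCell[ρ, d]`: «every member of the cell `(ρ, d)` carries one cycle with an irrational `σ`-eigenvalue».
Local notation only. -/
local notation3 (prettyPrint := false) "OneIrrCycleOnCell[" ρ ", " d "]" =>
  (∀ (X : SchemeOver ℂ) (hX : IsSmoothProjective 4 X), IsOfK3HilbertSquareType X →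
    ∀ (φ : complexBetti X 2 ≃ₗ[ℂ] (K3HilbertIndex → ℂ)) (P : complexBetti X (2 * 4)) (z : K3HilbertIndex → ℂ),
      MarkedK3Sq[X, φ, P, z] → ¬ SpIso[X, φ] → Module.finrank ℂ ↥(algebraicClasses X 1) = ρ →
        RMgen[X, φ, z, d] → OneIrrCycle[X, φ, z, hX])

/-- `Kap[φ, g] = Σ_{ij} (G⁻¹)_{ij} · φ⁻¹eᵢ ∪ g(φ⁻¹eⱼ) ∈ H⁴(X(ℂ); ℂ)`, the kappa class of an endomorphism `g`
of `H²(X(ℂ); ℂ)` (VERBATIM `…K3Sq2TypeHodgeGraphClassesGeneral`). Local notation only. -/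
local notation3 (prettyPrint := false) "Kap[" φ ", " g "]" =>
  (∑ i : K3HilbertIndex, ∑ j : K3HilbertIndex,
    (((k3HilbertGram 2).map (Int.cast : ℤ → ℂ))⁻¹ i j) •
      cupProduct (rfl : 2 + 2 = 2 * 2) ((LinearEquiv.symm φ) (Pi.single i 1))
        (g ((LinearEquiv.symm φ) (Pi.single j 1))))

variable {X : SchemeOver ℂ} {φ : complexBetti X 2 ≃ₗ[ℂ] (K3HilbertIndex → ℂ)} {P : complexBetti X (2 * 4)}
  {z : K3HilbertIndex → ℂ}

/-! ### The pointwise cell socket and the cell closers, all six cells -/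

/-- **POINTWISE CELL SOCKET, any cell** (module docstring): `RMgen[X, φ, z, d]` and ONE algebraic class acting with
`σ`-eigenvalue of minpoly degree `d` give `HodgeConjectureFor 4 X` for a marked smooth projective `K3^{[2]}`-type `X`
— `genX_of_rmGenerator_of_eigenvalue_natDegree` + the `X`-side F4 `hodgeConjectureFor_of_cycleInducedGenerator`. Modulo
{Verbitsky–Guan, O'Grady, `QInvAlgebraic`}; no `¬ SpannedByIsometries`, no degree law, no Kuga–Satake.
[cite: Markman2024, §1.1 Thm. 1.1] [cite: Varesco2023, §2 (p. 8)] [cite: Zarhin1983HodgeGroupsK3, Thm. 1.5.1] -/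
theorem hodgeConjectureFor_of_oneCellCycle_of_rmGenerator
    (hV : VerbitskyGuan_cohomology_K3HilbertSquareType) (hO : OGrady2008_dualBBFClass_algebraic) (hQ : QInvAlgebraic)
    (hX : IsSmoothProjective 4 X) (hK : IsOfK3HilbertSquareType X) (hM : MarkedK3Sq[X, φ, P, z]) {d : ℕ}
    (hR : RMgen[X, φ, z, d]) (h : OneCellCycle[X, φ, z, hX, d]) : HodgeConjectureFor 4 X := by
  obtain ⟨t, ht_rat, ht_typ, ht_cyc, ev, ht_ev, hdeg⟩ := h
  exact hodgeConjectureFor_of_cycleInducedGenerator hV hO hQ hX hK hM t ht_rat ht_typ ht_cyc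
    (genX_of_rmGenerator_of_eigenvalue_natDegree hX hM hR t ht_rat ht_typ ht_ev hdeg)

/-- **POINTWISE CELL SOCKET from the route's published facts** {Verbitsky–Guan, O'Grady, Charles–Markman 2013}.
CONDITIONAL; credits nothing. [cite: CharlesMarkman2013, Thm. 1.1 (§1)] [cite: Markman2024, §1.1 Thm. 1.1] -/
theorem hodgeConjectureFor_of_oneCellCycle_of_rmGenerator_of_charlesMarkman
    (hV : VerbitskyGuan_cohomology_K3HilbertSquareType) (hO : OGrady2008_dualBBFClass_algebraic)
    (hB : CharlesMarkman2013_lefschetzStandard_K3HilbertType)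
    (hX : IsSmoothProjective 4 X) (hK : IsOfK3HilbertSquareType X) (hM : MarkedK3Sq[X, φ, P, z]) {d : ℕ}
    (hR : RMgen[X, φ, z, d]) (h : OneCellCycle[X, φ, z, hX, d]) : HodgeConjectureFor 4 X :=
  hodgeConjectureFor_of_oneCellCycle_of_rmGenerator hV hO (qInvAlgebraic_of_charlesMarkman hV hB) hX hK hM hR h

/-- **One generating cycle per member ⟹ HC⁴ on the cell, for EVERY cell `(ρ, d)`** (incl. `(3,2)`, where the degree
law fails). Modulo {Verbitsky–Guan, O'Grady, `QInvAlgebraic`}. [cite: Markman2024, §1.1 Thm. 1.1]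
[cite: Zarhin1983HodgeGroupsK3, Thm. 1.5.1] -/
theorem cellHC_of_forall_oneGenCycle
    (hV : VerbitskyGuan_cohomology_K3HilbertSquareType) (hO : OGrady2008_dualBBFClass_algebraic) (hQ : QInvAlgebraic)
    {ρ d : ℕ} (h : OneCycleOnCell[ρ, d]) : CellHC[ρ, d] :=
  fun X hX hK φ P z hM hsp hρ hR =>
    hodgeConjectureFor_of_oneCellCycle_of_rmGenerator hV hO hQ hX hK hM hR (h X hX hK φ P z hM hsp hρ hR)

/-- **Cell `(3,2)`** — the one the degree law misses: one quadratic generating cycle per member ⟹ `CellHC[3, 2]`, with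
NO Kuga–Satake binder. Modulo {Verbitsky–Guan, O'Grady, `QInvAlgebraic`}. [cite: Markman2024, §1.1 Thm. 1.1] -/
theorem cellHC_of_forall_oneGenCycle_32
    (hV : VerbitskyGuan_cohomology_K3HilbertSquareType) (hO : OGrady2008_dualBBFClass_algebraic) (hQ : QInvAlgebraic)
    (h : OneCycleOnCell[3, 2]) : CellHC[3, 2] :=
  cellHC_of_forall_oneGenCycle hV hO hQ h

/-- **Crux #5 `LowPicardRealMultiplication` BY NAME ⟸ ONE generating cycle per member on each of its six cells**
(«CELL-SPLIT» `lowPicardRealMultiplication_of_six_cells` + `cellHC_of_forall_oneGenCycle`). Modulo {Verbitsky–Guan,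
O'Grady, `QInvAlgebraic`}; NO Kuga–Satake, NO degree law; CONDITIONAL on the six one-cycle clauses (open geometry);
credits nothing to HC. [cite: Markman2024, §1.1 Thm. 1.1] [cite: Vangeemen2008, Lemma 3.2]
[cite: Zarhin1983HodgeGroupsK3, Thm. 1.5.1 and Thm. 1.6] -/
theorem lowPicardRealMultiplication_of_forall_oneGenCycle
    (hV : VerbitskyGuan_cohomology_K3HilbertSquareType) (hO : OGrady2008_dualBBFClass_algebraic) (hQ : QInvAlgebraic)
    (h12 : OneCycleOnCell[1, 2]) (h23 : OneCycleOnCell[2, 3]) (h27 : OneCycleOnCell[2, 7])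
    (h32 : OneCycleOnCell[3, 2]) (h34 : OneCycleOnCell[3, 4]) (h35 : OneCycleOnCell[3, 5]) :
    Summit.HodgeConjecture.HodgeConjecture.Theses.MarkmanPartnerTransport.LowPicardRealMultiplication :=
  lowPicardRealMultiplication_of_six_cells (cellHC_of_forall_oneGenCycle hV hO hQ h12)
    (cellHC_of_forall_oneGenCycle hV hO hQ h23) (cellHC_of_forall_oneGenCycle hV hO hQ h27)
    (cellHC_of_forall_oneGenCycle hV hO hQ h32) (cellHC_of_forall_oneGenCycle hV hO hQ h34)
    (cellHC_of_forall_oneGenCycle hV hO hQ h35)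

/-- **Crux #5 BY NAME, cell-free form ⟸ «every marked smooth projective `K3^{[2]}`-type `X` with `ρ(X) ≤ 3` and an RM
generator of degree `d ≥ 2` carries ONE algebraic self-correspondence whose `σ`-eigenvalue has degree `d`»** («RM-GEN»
`exists_rmGenerator_of_not_spannedByIsometries` + the pointwise cell socket). Modulo {Verbitsky–Guan, O'Grady,
`QInvAlgebraic`}; CONDITIONAL on the one-cycle clause; credits nothing to HC. [cite: Markman2024, §1.1 Thm. 1.1]
[cite: Zarhin1983HodgeGroupsK3, Thm. 1.5.1 and Thm. 1.6] [cite: Vangeemen2008, Lemma 3.2] -/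
theorem lowPicardRealMultiplication_of_forall_oneGenCycle_of_rmGenerator
    (hV : VerbitskyGuan_cohomology_K3HilbertSquareType) (hO : OGrady2008_dualBBFClass_algebraic) (hQ : QInvAlgebraic)
    (h : ∀ (X : SchemeOver ℂ) (hX : IsSmoothProjective 4 X), IsOfK3HilbertSquareType X →
      ∀ (φ : complexBetti X 2 ≃ₗ[ℂ] (K3HilbertIndex → ℂ)) (P : complexBetti X (2 * 4)) (z : K3HilbertIndex → ℂ),
        MarkedK3Sq[X, φ, P, z] → Module.finrank ℂ ↥(algebraicClasses X 1) ≤ 3 →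
          ∀ d : ℕ, 2 ≤ d → RMgen[X, φ, z, d] → OneCellCycle[X, φ, z, hX, d]) :
    Summit.HodgeConjecture.HodgeConjecture.Theses.MarkmanPartnerTransport.LowPicardRealMultiplication := by
  intro X hX hK φ P z hM hsp hρ
  obtain ⟨d, hd, hR⟩ := exists_rmGenerator_of_not_spannedByIsometries hX hM hsp
  exact hodgeConjectureFor_of_oneCellCycle_of_rmGenerator hV hO hQ hX hK hM hR (h X hX hK φ P z hM hρ d hd hR)

/-- **Crux #5 BY NAME ⟸ one generating cycle per member on each cell, from the route's published facts**
{Verbitsky–Guan, O'Grady, Charles–Markman 2013}. CONDITIONAL; credits nothing. [cite: CharlesMarkman2013, Thm. 1.1 (§1)]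
[cite: Markman2024, §1.1 Thm. 1.1] -/
theorem lowPicardRealMultiplication_of_forall_oneGenCycle_of_charlesMarkman
    (hV : VerbitskyGuan_cohomology_K3HilbertSquareType) (hO : OGrady2008_dualBBFClass_algebraic)
    (hB : CharlesMarkman2013_lefschetzStandard_K3HilbertType)
    (h12 : OneCycleOnCell[1, 2]) (h23 : OneCycleOnCell[2, 3]) (h27 : OneCycleOnCell[2, 7])
    (h32 : OneCycleOnCell[3, 2]) (h34 : OneCycleOnCell[3, 4]) (h35 : OneCycleOnCell[3, 5]) :
    Summit.HodgeConjecture.HodgeConjecture.Theses.MarkmanPartnerTransport.LowPicardRealMultiplication :=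
  lowPicardRealMultiplication_of_forall_oneGenCycle hV hO (qInvAlgebraic_of_charlesMarkman hV hB) h12 h23 h27 h32 h34 h35

/-! ### Prime degree: one cycle with an IRRATIONAL eigenvalue per member -/

/-- **POINTWISE CELL SOCKET at prime degree**: `RMgen[X, φ, z, d]` with `d` PRIME and ONE algebraic class acting
rationally and type-preservingly with an IRRATIONAL `σ`-eigenvalue give `HodgeConjectureFor 4 X` for a marked smooth
projective `K3^{[2]}`-type `X` (`genX_of_rmGenerator_of_irrational_of_prime` + the `X`-side F4). Modulo {Verbitsky–Guan,
O'Grady, `QInvAlgebraic`}. [cite: Markman2024, §1.1 Thm. 1.1] [cite: Zarhin1983HodgeGroupsK3, Thm. 1.5.1] -/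
theorem hodgeConjectureFor_of_oneIrrCycle_of_rmGenerator_prime
    (hV : VerbitskyGuan_cohomology_K3HilbertSquareType) (hO : OGrady2008_dualBBFClass_algebraic) (hQ : QInvAlgebraic)
    (hX : IsSmoothProjective 4 X) (hK : IsOfK3HilbertSquareType X) (hM : MarkedK3Sq[X, φ, P, z]) {d : ℕ} (hp : d.Prime)
    (hR : RMgen[X, φ, z, d]) (h : OneIrrCycle[X, φ, z, hX]) : HodgeConjectureFor 4 X := by
  obtain ⟨t, ht_rat, ht_typ, ht_cyc, ev, ht_ev, hev⟩ := h
  exact hodgeConjectureFor_of_cycleInducedGenerator hV hO hQ hX hK hM t ht_rat ht_typ ht_cyc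
    (genX_of_rmGenerator_of_irrational_of_prime hX hM hp hR t ht_rat ht_typ ht_ev hev)

/-- **One cycle with an irrational `σ`-eigenvalue per member ⟹ HC⁴ on the cell, for every cell of PRIME degree `d`**
(cells `(1,2), (2,3), (2,7), (3,2), (3,5)` of crux #5). Modulo {Verbitsky–Guan, O'Grady, `QInvAlgebraic`}.
[cite: Markman2024, §1.1 Thm. 1.1] [cite: Zarhin1983HodgeGroupsK3, Thm. 1.5.1] -/
theorem cellHC_of_forall_oneIrrCycle
    (hV : VerbitskyGuan_cohomology_K3HilbertSquareType) (hO : OGrady2008_dualBBFClass_algebraic) (hQ : QInvAlgebraic)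
    {ρ d : ℕ} (hp : d.Prime) (h : OneIrrCycleOnCell[ρ, d]) : CellHC[ρ, d] :=
  fun X hX hK φ P z hM hsp hρ hR =>
    hodgeConjectureFor_of_oneIrrCycle_of_rmGenerator_prime hV hO hQ hX hK hM hp hR (h X hX hK φ P z hM hsp hρ hR)

/-- **Crux #5 `LowPicardRealMultiplication` BY NAME ⟸ one cycle with an IRRATIONAL `σ`-eigenvalue per member on the
five prime cells `(1,2), (2,3), (2,7), (3,2), (3,5)` + one cycle with a QUARTIC `σ`-eigenvalue per member on `(3,4)`**
(`cellHC_of_forall_oneIrrCycle` at `d ∈ {2, 3, 7, 2, 5}`, `cellHC_of_forall_oneGenCycle` at `(3,4)`, «CELL-SPLIT»).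
Modulo {Verbitsky–Guan, O'Grady, `QInvAlgebraic`}; NO Kuga–Satake, NO degree law; CONDITIONAL on the one-cycle clauses;
credits nothing to HC. [cite: Markman2024, §1.1 Thm. 1.1] [cite: Vangeemen2008, Lemma 3.2]
[cite: Zarhin1983HodgeGroupsK3, Thm. 1.5.1 and Thm. 1.6] -/
theorem lowPicardRealMultiplication_of_forall_oneIrrCycle_of_oneGenCycle34
    (hV : VerbitskyGuan_cohomology_K3HilbertSquareType) (hO : OGrady2008_dualBBFClass_algebraic) (hQ : QInvAlgebraic)
    (h12 : OneIrrCycleOnCell[1, 2]) (h23 : OneIrrCycleOnCell[2, 3]) (h27 : OneIrrCycleOnCell[2, 7])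
    (h32 : OneIrrCycleOnCell[3, 2]) (h34 : OneCycleOnCell[3, 4]) (h35 : OneIrrCycleOnCell[3, 5]) :
    Summit.HodgeConjecture.HodgeConjecture.Theses.MarkmanPartnerTransport.LowPicardRealMultiplication :=
  lowPicardRealMultiplication_of_six_cells (cellHC_of_forall_oneIrrCycle hV hO hQ Nat.prime_two h12)
    (cellHC_of_forall_oneIrrCycle hV hO hQ Nat.prime_three h23)
    (cellHC_of_forall_oneIrrCycle hV hO hQ (by norm_num) h27)
    (cellHC_of_forall_oneIrrCycle hV hO hQ Nat.prime_two h32) (cellHC_of_forall_oneGenCycle hV hO hQ h34)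
    (cellHC_of_forall_oneIrrCycle hV hO hQ (by norm_num) h35)

/-! ### LOSSLESS: HC⁴ on a cell ⟹ one generating cycle per member (the RM generator itself is cycle-induced) -/

/-- **The converse, pointwise**: if `HodgeConjectureFor 4 X` holds for a marked smooth projective `K3^{[2]}`-type `X`
with `RMgen[X, φ, z, d]`, then `X` carries `OneCellCycle[X, φ, z, hX, d]` — the RM GENERATOR `θ` itself: its kappa class
`κ_θ` is a rational `(2,2)`-class, hence algebraic (`OrphanSR.kappaClass_mem_algebraicClasses_of_hodgeConjectureFor`,
fact-free), so the `q`-self-adjoint `θ` is cycle-induced (T3C `exists_corrAction_eq_of_kappaClass`, mod {Verbitsky–Guan,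
Charles–Markman 2013}), and its `σ`-eigenvalue has degree `d`. [cite: CharlesMarkman2013, Thm. 1.1 (§1)]
[cite: OGrady2008NumericalK3Square, §2.2 Remark 2.1] [cite: Markman2024, §1.1 Thm. 1.1] -/
theorem oneCellCycle_of_hodgeConjectureFor_of_rmGenerator
    (hV : VerbitskyGuan_cohomology_K3HilbertSquareType) (hB : CharlesMarkman2013_lefschetzStandard_K3HilbertType)
    (hX : IsSmoothProjective 4 X) (hK : IsOfK3HilbertSquareType X) (hM : MarkedK3Sq[X, φ, P, z]) {d : ℕ}
    (hR : RMgen[X, φ, z, d]) (h : HodgeConjectureFor 4 X) : OneCellCycle[X, φ, z, hX, d] := by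
  obtain ⟨θ, h1, h2, h5, evθ, hθσ, -, hdegθ, -, -⟩ := hR
  exact ⟨θ, h1, h2, exists_corrAction_eq_of_kappaClass hV hB hX hK hM θ h5
    (OrphanSR.kappaClass_mem_algebraicClasses_of_hodgeConjectureFor hX hM h θ h1 h2), evθ, hθσ, hdegθ⟩

/-- **`CellHC[ρ, d] → OneCycleOnCell[ρ, d]`** for every cell. Modulo {Verbitsky–Guan, Charles–Markman 2013}.
[cite: CharlesMarkman2013, Thm. 1.1 (§1)] [cite: OGrady2008NumericalK3Square, §2.2 Remark 2.1] -/
theorem oneCycleOnCell_of_cellHC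
    (hV : VerbitskyGuan_cohomology_K3HilbertSquareType) (hB : CharlesMarkman2013_lefschetzStandard_K3HilbertType)
    {ρ d : ℕ} (h : CellHC[ρ, d]) : OneCycleOnCell[ρ, d] :=
  fun X hX hK φ P z hM hsp hρ hR =>
    oneCellCycle_of_hodgeConjectureFor_of_rmGenerator hV hB hX hK hM hR (h X hX hK φ P z hM hsp hρ hR)

/-- **LOSSLESS: HC⁴ on a cell ⟺ one generating cycle per member — `CellHC[ρ, d] ↔ OneCycleOnCell[ρ, d]` for EVERY
`(ρ, d)`**, modulo {Verbitsky–Guan, O'Grady, Charles–Markman 2013} (`QInvAlgebraic` by `qInvAlgebraic_of_charlesMarkman`).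
The one-cycle reduction of crux #5 loses nothing. [cite: CharlesMarkman2013, Thm. 1.1 (§1)] [cite: Markman2024, §1.1 Thm. 1.1]
[cite: Zarhin1983HodgeGroupsK3, Thm. 1.5.1] -/
theorem cellHC_iff_oneCycleOnCell
    (hV : VerbitskyGuan_cohomology_K3HilbertSquareType) (hO : OGrady2008_dualBBFClass_algebraic)
    (hB : CharlesMarkman2013_lefschetzStandard_K3HilbertType) {ρ d : ℕ} : CellHC[ρ, d] ↔ OneCycleOnCell[ρ, d] :=
  ⟨oneCycleOnCell_of_cellHC hV hB, cellHC_of_forall_oneGenCycle hV hO (qInvAlgebraic_of_charlesMarkman hV hB)⟩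

/-- **Crux #5 `LowPicardRealMultiplication` ⟺ one generating cycle per member on each of its six cells** — the
one-cycle form of the crux is EXACT («CELL-SPLIT» both ways, `lowPicardRealMultiplication_iff_six_cells`, and
`cellHC_iff_oneCycleOnCell`). Modulo {Verbitsky–Guan, O'Grady, Charles–Markman 2013}; credits nothing to HC.
[cite: CharlesMarkman2013, Thm. 1.1 (§1)] [cite: Markman2024, §1.1 Thm. 1.1] [cite: Vangeemen2008, Lemma 3.2]
[cite: Zarhin1983HodgeGroupsK3, Thm. 1.5.1 and Thm. 1.6] -/
theorem lowPicardRealMultiplication_iff_forall_oneGenCycle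
    (hV : VerbitskyGuan_cohomology_K3HilbertSquareType) (hO : OGrady2008_dualBBFClass_algebraic)
    (hB : CharlesMarkman2013_lefschetzStandard_K3HilbertType) :
    Summit.HodgeConjecture.HodgeConjecture.Theses.MarkmanPartnerTransport.LowPicardRealMultiplication ↔
      (OneCycleOnCell[1, 2] ∧ OneCycleOnCell[2, 3] ∧ OneCycleOnCell[2, 7] ∧ OneCycleOnCell[3, 2] ∧
        OneCycleOnCell[3, 4] ∧ OneCycleOnCell[3, 5]) := by
  rw [lowPicardRealMultiplication_iff_six_cells]
  exact and_congr (cellHC_iff_oneCycleOnCell hV hO hB) (and_congr (cellHC_iff_oneCycleOnCell hV hO hB)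
    (and_congr (cellHC_iff_oneCycleOnCell hV hO hB) (and_congr (cellHC_iff_oneCycleOnCell hV hO hB)
      (and_congr (cellHC_iff_oneCycleOnCell hV hO hB) (cellHC_iff_oneCycleOnCell hV hO hB)))))

end Summit.HodgeConjecture.HodgeConjecture.Theorems.MarkmanPartnerTransport.PartnerLattice

end
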